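import Summits.AtomisticToContinuum.Crystallization.Theorems.OverbindingBudgetAffineStrainBand

/-!
(SPLIT FOR THE 400-LINE CAP by the landing lane, hand-2 g49: this file = part A (§1–§4b); part B = `…OverbindingBudgetAffineCalmDescent` imports it; same namespace, all FQNs unchanged.)
# NODE g102 «CalmDescent» (lens-4) — the coarse MID layer in EQUILIBRIUM NORMAL FORM:
# `CoarseMid ⟸ AgitGain ∧ DilatedDeep ∧ CalmRigidity ∧ LooseCalm ∧ OpticCalm`, glue PROVED (0 sorry)

TARGET (31280 residual of record after g101, critic r1881: `InterfaceDominance ⟸ SW♭₃₀ ∧ MildBand ∧ StrongBand ∧ CoarseMid ∧ ThinFault`, tree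
`…AffineStrainBand.interfaceDominance_of_swapWide30_bands`): its blocker leaf **`CoarseMid`** `= TameBalancedAffMidGap 64 12 (1/10⁴) (1/25) (3/50)
(1/450)` — every `64`-deep registered site whose `12·nn`-ball is not `(1/10⁴, 1/25)`-affinely registered («MID at `η = 1/10⁴`») pays, against
`#{not 64-deep}`, at every window `[δ, 2]`.  Status before this node: UNDECIDED · IDEA-NEEDED (read as «PM at `1/10⁴`»: polytype margins).

EXTREMAL QUESTION (lens «minimal counterexample / extremal reduction»).  What may a counterexample `y` to `CoarseMid` be FORCED to look like near a
priced site, at no cost?  The record cone consumes every W-census only at texture level through `misfitRelax_of_tameBalancedMisfitGap` →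
`GrossLiouvilleLaw`, whose configurations are `LocallyOptimal ∧ VirialBalanced` — the census is only ever needed near EQUILIBRIA.  This node
realises the equilibrium normal form INSIDE the arbitrary-`y` census, by excluded middle on a potential-level predicate and two new elementary
currencies, so that no seam above `CoarseMid` changes:
* **`Calm δ τ L y i`** — the `L·nn`-ball of `i` is `(3/50, 1/450)`-registered and every site in it is in the window, TIGHT (`nn ≤ 21/20`) and
  `τ`-force-balanced (`‖ljSiteGrad y ·‖ ≤ τ`, the FULL Lennard-Jones gradient).  A MID site that is not calm sees within `L·nn ≤ 2L` an
  off-window site (rebated), a DILATED deep site or an AGITATED site — charged by witness packing (tree `natCard_le_mul_of_witness`) to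
  **`DilatedDeep`** («`64`-deep in-window sites with `nn > 21/20` pay»: ≥ `8.1 %` dilated, EOS income `e(1.05) − e⋆ ≈ 0.100` per site; scale
  currency) and **`AgitGain`** («in-window sites with `‖ljSiteGrad‖ ≥ τ` pay»: move every agitated site with bounded junk curvature by `−t·∇/‖∇‖`
  simultaneously — gain `≥ τ²/2Λ` each by the Schur row-sum bound on the Hessian over `δ`-separated matter, the agitated sites spoiled by
  off-window junk number `≤ Λ(δ)/Λ₀ · #off` by Markov, and the moved configuration is priced by the FREE floor `floor_le`; force currency).
* A calm MID site is, by **`CalmRigidity`** (energy-free: «a calm registered tight ball is locally HOMOGENEOUS to any precision `η₂`, given calm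
  depth `L(η₂)`» — the registered Liouville property of Lennard-Jones equilibria; compactness + phonon-gap Saint-Venant decay on the linear side),
  `η₂`-homogeneous on its `12·nn`-ball in the sense **`OptReg`**: affinely framed UP TO A COMMON TRANSLATION `w` OF THE TWELVE OFF-PLANE PATTERN
  POINTS — the even internal («optical») mode of a stacking.  This mode is FORCED by the numerics of this generation (memo §3 OPTICBOX): the hcp
  sublattice relaxes under in-plane shear `ε` by `w = 0.83·ε·a` (linear), so internally relaxed h-matter sheared by `≥ 1.2·10⁻⁴` is NOT
  `(1/10⁴)`-affine — it is MID matter invisible to the bands (`BandSite`/`ShearSite` demand `AffDeepReg` at `1/10⁴`); and the relaxed polytypes'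
  `d₊ ≠ d₋` (STACKBOX: two-shell non-affinity `≤ 1.6·10⁻⁵ = η/6.3`) is the same mode along `ĉ`.  So `CoarseMid` is NOT «PM at `1/10⁴`» (empty by
  STACKBOX) but the OPTIC BAND plus the loose sliver, once defects, dilation and agitation are packed away.
* The calm MID site then sees within `12·nn` a calm `η₂`-homogeneous site whose OWN cluster is not `(1/10⁴, 1/25)`-affine: either affine with strain in
  `(1/25, 1/10]` — **`LooseCalm`** (EOS income `≥ c_W/625 ≈ 4.9·10⁻³` per site, margin `×10⁴`; a sliver, registration caps strain near `4.2 %`) — or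
  not `(1/10⁴, 1/10)`-affine at all, i.e. carrying optical content `|w| ≳ 10⁻⁴` — **`OpticCalm`** (internally relaxed sheared h-matter, in-plane shear
  `≥ 1.2·10⁻⁴`; EOS income `≥ c_W(hcp, relaxed C₆₆)·ε² ≈ 8·10⁻⁸` at the corner; its Cauchy–Born leak is NOT the arbitrary-`y` exchange `κ_Z = 2.7·10⁻⁷`
  but `≈ 2c_W·ε·η₂·k` per site, a DIAL: `η₂ = 10⁻⁶` gives margin `×10`, and `CalmRigidity` supplies any `η₂` at calm depth `L ≈ 10³`).
  Packing again (`R₀ = 24`).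

PIECES (all typed below; `η = 1/10⁴`; rebate `notDeep₆₄ := notDeepCount 64 (3/50) (1/450)` throughout):
* `AgitGain`      — NEW currency (force) · TRUE-type · ATTACKABLE-S (the relaxation proof above is complete on paper; rebate unused on paper) · not implied by `CoarseMid`.
* `DilatedDeep`   — scale currency · TRUE-type (EOS at `≥ 8.1 %` dilation) · not implied by `CoarseMid` alone (the affine ladder is scale-free) but
                    BELOW THE APEX: `DilatedDeep ⟸ TameBalancedDeepScaleGap (122/125) 0 ρ (3/50) (1/450)`, any `ρ ≤ 64` (PROVED `dilatedDeep_of_tbdsg`;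
                    «TBDSG», `ρ = 4`, is an internal node of the record cone) — it adds no strength to the leaf set.
* `CalmRigidity`  — energy-free · UNDECIDED · ATTACKABLE-L (linearised: Saint-Venant decay with the phonon gap of BORNBOX-stable matter, `nn ≤ 21/20` keeps the
                    Legendre–Hadamard constant `≥ 0.667` (fcc) / `0.944` (hcp), loss only at `nn ≈ 1.077`) · INSTRUMENTABLE «TWINBOX» (is any relaxed coherent twin /
                    special boundary of LJ fcc/hcp `(3/50)`-two-shell-registered with `nn ≤ 21/20`? if yes the statement is FALSE as typed and `Calm` must carry a
                    tighter registration) · why it might fail: a `(3/50)`-registered, tight, force-balanced entire LJ configuration that is not a strained stacking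
                    (nonlinear Liouville at `4 %` data is not perturbative).
* `LooseCalm`     — WEAKER than `CoarseMid` (PROVED) · TRUE-type · ATTACKABLE-M (sitewise EOS, margin `×10⁴`).
* `OpticCalm`     — WEAKER than `CoarseMid` (PROVED) · TRUE-type · ATTACKABLE-L (Cauchy–Born in the calm class) · INSTRUMENTED «OPTICBOX» (`Γ = 0.83`) · why it might
                    fail: only through constants — the relaxed in-plane shear modulus of hcp (income) against `2c_W ε η₂ k` (leak), both dials free.
SEAMS (PROVED): `looseCalm_of_coarseMid`, `opticCalm_of_coarseMid` (weaker sides); `dilatedDeep_of_tbdsg` (below the apex); `affMidCount_le_calm_split`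
(the pointwise normal form at depth `L + 128/δ`); `midW_of_pieces` (one window); **`coarseMid_of_pieces`**; the record seam
`interfaceDominance_of_swapWide30_calm` and the cone `rdef_of_ceg_shape_calmDescent_record` (tree cone BY NAME, `CoarseMid` discharged).  So the leaf
set changes by: `CoarseMid` OUT; `AgitGain` [TRUE-type, paper proof complete] and `CalmRigidity` [the crux] IN; `LooseCalm`, `OpticCalm`, `DilatedDeep`
are consequences of the old leaves.  MUST-FAIL probes and `#h21_crux_probe` verdicts: `HOME/decomp-a2c-lens-4/g102/bc/`.

WHY NOVEL.  g100's CalmCut died on three barriers (gains leak, regularity buys `10⁻²` at depth `64`, relaxation heals MID sites); here (a) no gain is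
threaded — the competitor is priced by the free `floor_le`; (b) depth is a dial `L`, homogeneity a dial `η₂`; (c) no site is relaxed — calmness is a
PREDICATE split by excluded middle, its failure a chargeable witness.  The optical mode (`OptReg`) is new vocabulary forced by OPTICBOX; without it
`CalmRigidity` would be false on uniformly sheared relaxed hcp.
-/

namespace Summit.AtomisticToContinuum.Crystallization.Theorems.OverbindingBudgetAffineCalmDescent

open scoped BigOperators Classical
open Literature.MathematicalPhysics.StatisticalMechanics
open Literature.Geometry.DiscreteGeometry (IsChargeFree nearestDist nearestDist_nonneg nearestDist_le_dist fccTwoShellPattern hcpTwoShellPattern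
  bondGraph)
open Summit.AtomisticToContinuum.Crystallization.Theorems.OverbindingBudgetMisfitCensusStatements (Bad Short Long)
open Summit.AtomisticToContinuum.Crystallization.Theorems.OverbindingBudgetMisfitRegistration (Framed Reg DeepReg regScaleCount)
open Summit.AtomisticToContinuum.Crystallization.Theorems.OverbindingBudgetMisfitWindowStatements (InWindow offCount)
open Summit.AtomisticToContinuum.Crystallization.Theorems.OverbindingBudgetBalancedCensusStatements
open Summit.AtomisticToContinuum.Crystallization.Theorems.OverbindingBudgetAffineLadder
open Summit.AtomisticToContinuum.Crystallization.Theorems.OverbindingBudgetAffineMesoCut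
open Summit.AtomisticToContinuum.Crystallization.Theorems.OverbindingBudgetAffinePhaseCut
open Summit.AtomisticToContinuum.Crystallization.Theorems.OverbindingBudgetAffineCushionCut
open Summit.AtomisticToContinuum.Crystallization.Theorems.OverbindingBudgetAffineTwinCut
open Summit.AtomisticToContinuum.Crystallization.Theorems.OverbindingBudgetAffineRunCut
open Summit.AtomisticToContinuum.Crystallization.Theorems.OverbindingBudgetAffineCompressedCut
open Summit.AtomisticToContinuum.Crystallization.Theorems.OverbindingBudgetAffineRunCutFlat
open Summit.AtomisticToContinuum.Crystallization.Theorems.OverbindingBudgetAffineWildCut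
open Summit.AtomisticToContinuum.Crystallization.Theorems.OverbindingBudgetAffineCoreDescent
open Summit.AtomisticToContinuum.Crystallization.Theorems.OverbindingBudgetAffineStrainBand

variable {N : ℕ}

/-! ## §1  New vocabulary: the optical mode, the site gradient, calmness -/

/-- Off-plane indicator of a two-shell pattern point, in the cuboctahedron coordinates of `fccInt` / `hcpInt`: the hexagonal layer through the
centre is `v₀ + v₁ + v₂ = 0` (six points); the six points above and the six below have `v₀ + v₁ + v₂ ≠ 0`. -/
noncomputable def offBasal (v : EuclideanSpace ℝ (Fin 3)) : ℝ :=
  if v 0 + v 1 + v 2 = 0 then 0 else 1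

/-- `OptFramed ε θ g y i` («optically-affinely two-shell framed»): as `AffFramed ε θ g y i`, except that the twelve OFF-PLANE pattern points are
moreover translated by a common vector `w`, `‖w‖ ≤ θ` (in `nn` units) — the EVEN layer mode: both adjacent close-packed layers displaced by the same
`w` relative to the affine image.  It is (a) the internal (optical) sublattice shift of hcp under in-plane shear (`|w| = 0.83·ε`, OPTICBOX), (b) the
`d₊ ≠ d₋` relaxation of polytype layers (`w ∥ ĉ`, STACKBOX), and (c) for ANY stacking the layer-normal CURVATURE of the displacement,
`w = (d²/2)·∂²u/∂z²` — so `OptReg`-homogeneity means «affine up to layer-normal curvature and optical shift»; in-plane curvature is not absorbed.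
`w = 0` is `AffFramed`. -/
def OptFramed (ε θ g : ℝ) (y : Fin N → EuclideanSpace ℝ (Fin 3)) (i : Fin N) : Prop :=
  ∃ (Q : EuclideanSpace ℝ (Fin 3) →ₗᵢ[ℝ] EuclideanSpace ℝ (Fin 3)) (A : EuclideanSpace ℝ (Fin 3) →ₗ[ℝ] EuclideanSpace ℝ (Fin 3))
    (w : EuclideanSpace ℝ (Fin 3)) (P : Finset (EuclideanSpace ℝ (Fin 3))) (f : EuclideanSpace ℝ (Fin 3) → EuclideanSpace ℝ (Fin 3)),
    (P = fccTwoShellPattern ∨ P = hcpTwoShellPattern) ∧ (∀ v ∈ P, ‖A v - Q v‖ ≤ θ) ∧ ‖w‖ ≤ θ ∧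
    (∀ v ∈ P, f v ∈ Set.range y ∧ dist (f v) (y i + nearestDist y i • (A v + offBasal v • w)) ≤ ε * nearestDist y i) ∧
    Set.InjOn f ↑P ∧
    ∀ k : Fin N, k ≠ i → dist (y k) (y i) ≤ (3 / 2 + g) * nearestDist y i → ∃ v ∈ P, f v = y k

/-- `OptReg ε θ g y i`: `i` is `(1/100)`-charge-free and optically-affinely framed. -/
def OptReg (ε θ g : ℝ) (y : Fin N → EuclideanSpace ℝ (Fin 3)) (i : Fin N) : Prop :=
  IsChargeFree (1 / 100 : ℝ) y i ∧ OptFramed ε θ g y i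

/-- `OptDeepReg ρ ε θ g y i`: every site within `ρ · nearestDist y i` of `y i` (including `i`) is `OptReg ε θ g`. -/
def OptDeepReg (ρ ε θ g : ℝ) (y : Fin N → EuclideanSpace ℝ (Fin 3)) (i : Fin N) : Prop :=
  ∀ i' : Fin N, dist (y i') (y i) ≤ ρ * nearestDist y i → OptReg ε θ g y i'

/-- `ljSiteGrad y j := Σ_{k ≠ j} V′(|y j − y k|)/|y j − y k| • (y j − y k)` — the gradient of `interactionEnergy lennardJones` in the variable `y j`
(the total force on `j` is `−ljSiteGrad y j`). -/
noncomputable def ljSiteGrad (y : Fin N → EuclideanSpace ℝ (Fin 3)) (j : Fin N) : EuclideanSpace ℝ (Fin 3) :=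
  ∑ k ∈ Finset.univ.filter (fun k => k ≠ j), (deriv lennardJones (dist (y j) (y k)) / dist (y j) (y k)) • (y j - y k)

/-- `Agitated δ τ y j`: `j` is in the window `[δ, 2]` and the force on it has norm `≥ τ`. -/
def Agitated (δ τ : ℝ) (y : Fin N → EuclideanSpace ℝ (Fin 3)) (j : Fin N) : Prop :=
  InWindow δ 2 y j ∧ τ ≤ ‖ljSiteGrad y j‖

/-- `#Agitated δ τ`. -/
noncomputable def agitCount (δ τ : ℝ) (y : Fin N → EuclideanSpace ℝ (Fin 3)) : ℕ :=
  Nat.card {j // Agitated δ τ y j}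

/-- `Dilated δ y j`: `j` is `(64, 3/50, 1/450)`-deeply registered, in the window `[δ, 2]`, and `nearestDist y j > 21/20` (dilated by `≥ 8.1 %`
over `a⋆ = 0.9713`; BORNBOX: strong ellipticity is kept up to `nn ≈ 1.077`). -/
def Dilated (δ : ℝ) (y : Fin N → EuclideanSpace ℝ (Fin 3)) (j : Fin N) : Prop :=
  DeepReg 64 (3 / 50) (1 / 450) y j ∧ InWindow δ 2 y j ∧ (21 / 20 : ℝ) < nearestDist y j

/-- `#Dilated δ`. -/
noncomputable def dilatedCount (δ : ℝ) (y : Fin N → EuclideanSpace ℝ (Fin 3)) : ℕ :=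
  Nat.card {j // Dilated δ y j}

/-- `Calm δ τ L y i`: the `L·nn`-ball of `i` is `(3/50, 1/450)`-registered, and every site in it (including `i`) is in the window `[δ, 2]`, tight
(`nn ≤ 21/20`) and `τ`-force-balanced. -/
def Calm (δ τ L : ℝ) (y : Fin N → EuclideanSpace ℝ (Fin 3)) (i : Fin N) : Prop :=
  DeepReg L (3 / 50) (1 / 450) y i ∧
    ∀ i' : Fin N, dist (y i') (y i) ≤ L * nearestDist y i → InWindow δ 2 y i' ∧ nearestDist y i' ≤ 21 / 20 ∧ ‖ljSiteGrad y i'‖ ≤ τ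

/-- `LooseCalmSite δ η₂ τ L y i`: `i` is `64`-deep, calm out to `L·nn` AND `η₂`-homogeneous out to `L·nn` (`OptDeepReg L η₂ (1/10)`: every site of
the calm ball is `OptReg η₂`), its own cluster `(1/10⁴, 1/10)`- but not `(1/10⁴, 1/25)`-affinely registered — affine, strained beyond `1/25`.
(The glue delivers the homogeneity on the whole ball from `CalmRigidity`; the prover of `LooseCalm` may use it grain-wise.) -/
def LooseCalmSite (δ η₂ τ L : ℝ) (y : Fin N → EuclideanSpace ℝ (Fin 3)) (i : Fin N) : Prop :=
  DeepReg 64 (3 / 50) (1 / 450) y i ∧ Calm δ τ L y i ∧ OptDeepReg L η₂ (1 / 10) (1 / 450) y i ∧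
    AffReg (1 / 10 ^ 4) (1 / 10) (1 / 450) y i ∧ ¬ AffReg (1 / 10 ^ 4) (1 / 25) (1 / 450) y i

/-- `OpticCalmSite δ η₂ τ L y i`: `i` is `64`-deep, calm and `η₂`-homogeneous out to `L·nn` (`OptDeepReg L η₂ (1/10)`), and its own cluster is NOT
`(1/10⁴, 1/10)`-affinely registered — homogeneous with optical / layer-normal-curvature content `|w| ≳ 10⁻⁴` (internally relaxed sheared h-matter;
neutral layers of a bent stack). -/
def OpticCalmSite (δ η₂ τ L : ℝ) (y : Fin N → EuclideanSpace ℝ (Fin 3)) (i : Fin N) : Prop :=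
  DeepReg 64 (3 / 50) (1 / 450) y i ∧ Calm δ τ L y i ∧ OptDeepReg L η₂ (1 / 10) (1 / 450) y i ∧ ¬ AffReg (1 / 10 ^ 4) (1 / 10) (1 / 450) y i

/-- `#LooseCalmSite`. -/
noncomputable def looseCalmCount (δ η₂ τ L : ℝ) (y : Fin N → EuclideanSpace ℝ (Fin 3)) : ℕ :=
  Nat.card {i // LooseCalmSite δ η₂ τ L y i}

/-- `#OpticCalmSite`. -/
noncomputable def opticCalmCount (δ η₂ τ L : ℝ) (y : Fin N → EuclideanSpace ℝ (Fin 3)) : ℕ :=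
  Nat.card {i // OpticCalmSite δ η₂ τ L y i}

/-! ## §2  The five pieces -/

/-- **`AgitGain`** [route statement · this node · kind: crux-candidate · NEW (force currency) · TRUE-type · ATTACKABLE-S — simultaneous relaxation of
the agitated sites with bounded junk curvature, Schur bound on the LJ Hessian over `δ`-separated matter, Markov count of junk-spoiled sites
`≤ Λ(δ)/Λ₀·#off`, free floor `floor_le` at the moved configuration; the rebate is not used on paper · not implied by `CoarseMid` · why it might fail:
only if the Hessian row-sum bound along the relaxation segment were not uniform (it is: in-window sites stay `δ/2`-separated for `t ≤ δ/4`)]: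
at every window and every `τ > 0`, the in-window sites with force `≥ τ` pay. -/
def AgitGain : Prop :=
  ∀ δ : ℝ, 0 < δ → δ ≤ 2 → ∀ τ : ℝ, 0 < τ →
    CensusW (fun y => agitCount δ τ y) (fun y => notDeepCount 64 (3 / 50) (1 / 450) y) δ 2

/-- **`DilatedDeep`** [route statement · this node · kind: support · scale currency · TRUE-type (EOS: `e(1.05) − e⋆ ≈ 0.100` per site in tree units) ·
BELOW THE APEX «TBDSG» (PROVED `dilatedDeep_of_tbdsg`: a dilated site is a deeply registered LONG scale-bad site at `a = 122/125`) · not implied by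
`CoarseMid` alone (the affine ladder is scale-free) · why it might fail: only with TBDSG itself]: at every window, the `64`-deep in-window sites with
`nn > 21/20` pay. -/
def DilatedDeep : Prop :=
  ∀ δ : ℝ, 0 < δ → δ ≤ 2 → CensusW (fun y => dilatedCount δ y) (fun y => notDeepCount 64 (3 / 50) (1 / 450) y) δ 2

/-- **`CalmRigidity`** [route statement · this node · kind: crux · ENERGY-FREE · NEW («registered Liouville») · UNDECIDED · ATTACKABLE-L (compactness
+ Saint-Venant decay with the phonon gap; BORNBOX) · INSTRUMENTABLE «TWINBOX» · why it might fail: a `(3/50)`-registered, tight, force-balanced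
entire LJ configuration that is not a strained internally-relaxed stacking]: for every window and every precision `η₂ > 0` there are a force
tolerance `τ > 0` and a depth `L` such that every calm site is `η₂`-homogeneous on its `12·nn`-ball, `OptDeepReg 12 η₂ (1/10) (1/450)`. -/
def CalmRigidity : Prop :=
  ∀ δ : ℝ, 0 < δ → δ ≤ 2 → ∀ η₂ : ℝ, 0 < η₂ → ∃ τ L : ℝ, 0 < τ ∧ 0 ≤ L ∧
    ∀ (N : ℕ) (y : Fin N → EuclideanSpace ℝ (Fin 3)), Function.Injective y →
      ∀ i : Fin N, Calm δ τ L y i → OptDeepReg 12 η₂ (1 / 10) (1 / 450) y i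

/-- **`LooseCalm`** [route statement · this node · kind: support · WEAKER than `CoarseMid` (PROVED `looseCalm_of_coarseMid`) · TRUE-type (EOS,
strain `∈ (1/25, 1/10]`: income `≥ c_W/625 ≈ 4.9·10⁻³` per site) · ATTACKABLE-M (grain-wise Cauchy–Born on the calm homogeneous ball) · why it might
fail: nothing structural; the sliver is nearly empty (registration caps strain near `4.2 %`)]: at every window there are `η₂, τ₁ > 0`, `L₁` such that
for all `0 < τ ≤ τ₁`, `L ≥ L₁` the loose calm sites pay (all three dials in the prover's favour). -/
def LooseCalm : Prop :=
  ∀ δ : ℝ, 0 < δ → δ ≤ 2 → ∃ η₂ τ₁ L₁ : ℝ, 0 < η₂ ∧ 0 < τ₁ ∧ ∀ τ L : ℝ, 0 < τ → τ ≤ τ₁ → L₁ ≤ L →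
    CensusW (fun y => looseCalmCount δ η₂ τ L y) (fun y => notDeepCount 64 (3 / 50) (1 / 450) y) δ 2

/-- **`OpticCalm`** [route statement · this node · kind: crux · WEAKER than `CoarseMid` (PROVED `opticCalm_of_coarseMid`) · TRUE-type (EOS of
internally relaxed sheared h-matter, income `≥ c_W·ε²`, `ε ≥ 1.2·10⁻⁴`; calmness forces the optical shift to be the equilibrium response, `τ₁` small) ·
ATTACKABLE-L (Cauchy–Born in the calm homogeneous class: leak `≈ 2c_W ε η₂ k` per site, dials `η₂`, `L`) · INSTRUMENTED «OPTICBOX» (`Γ = 0.83`) · why it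
might fail: the curvature reading of `w` — a neutral layer of a locally bent stack is an optic calm site with own income only `≈ c(2w)²`, to be
collected from the adjacent layers by a 1-D summation by parts; otherwise only through constants (relaxed hcp `C₆₆` vs the `η₂`-leak), both dials free]:
same quantifier shape as `LooseCalm`, for the optic calm sites. -/
def OpticCalm : Prop :=
  ∀ δ : ℝ, 0 < δ → δ ≤ 2 → ∃ η₂ τ₁ L₁ : ℝ, 0 < η₂ ∧ 0 < τ₁ ∧ ∀ τ L : ℝ, 0 < τ → τ ≤ τ₁ → L₁ ≤ L →
    CensusW (fun y => opticCalmCount δ η₂ τ L y) (fun y => notDeepCount 64 (3 / 50) (1 / 450) y) δ 2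

/-! ## §3  Elementary relations (formal bookkeeping) -/

/-- `AffFramed` is `OptFramed` with `w = 0` (`θ ≥ 0`). [this node] -/
theorem optFramed_of_affFramed {ε θ g : ℝ} (hθ : 0 ≤ θ) {y : Fin N → EuclideanSpace ℝ (Fin 3)} {i : Fin N}
    (h : AffFramed ε θ g y i) : OptFramed ε θ g y i := by
  obtain ⟨Q, A, P, f, hP, hA, hf, hinj, hcomp⟩ := h
  refine ⟨Q, A, 0, P, f, hP, hA, by simpa using hθ, fun v hv => ?_, hinj, hcomp⟩
  simpa using hf v hv

/-- `AffReg ⇒ OptReg` (`θ ≥ 0`). [this node] -/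
theorem optReg_of_affReg {ε θ g : ℝ} (hθ : 0 ≤ θ) {y : Fin N → EuclideanSpace ℝ (Fin 3)} {i : Fin N} (h : AffReg ε θ g y i) :
    OptReg ε θ g y i :=
  ⟨h.1, optFramed_of_affFramed hθ h.2⟩

/-- `OptFramed` is monotone in the matching precision `ε`. [this node] -/
theorem optFramed_mono {ε ε' θ g : ℝ} (hε : ε ≤ ε') {y : Fin N → EuclideanSpace ℝ (Fin 3)} {i : Fin N} (h : OptFramed ε θ g y i) :
    OptFramed ε' θ g y i := by
  obtain ⟨Q, A, w, P, f, hP, hA, hw, hf, hinj, hcomp⟩ := h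
  refine ⟨Q, A, w, P, f, hP, hA, hw, fun v hv => ⟨(hf v hv).1, ?_⟩, hinj, hcomp⟩
  exact (hf v hv).2.trans (mul_le_mul_of_nonneg_right hε (nearestDist_nonneg y i))

/-- `OptReg` is monotone in `ε`. [this node] -/
theorem optReg_mono {ε ε' θ g : ℝ} (hε : ε ≤ ε') {y : Fin N → EuclideanSpace ℝ (Fin 3)} {i : Fin N} (h : OptReg ε θ g y i) :
    OptReg ε' θ g y i :=
  ⟨h.1, optFramed_mono hε h.2⟩

/-- `OptDeepReg` is monotone in `ε` and antitone in the radius. [this node] -/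
theorem optDeepReg_mono {ρ ρ' ε ε' θ g : ℝ} (hρ : ρ' ≤ ρ) (hε : ε ≤ ε') {y : Fin N → EuclideanSpace ℝ (Fin 3)} {i : Fin N}
    (h : OptDeepReg ρ ε θ g y i) : OptDeepReg ρ' ε' θ g y i :=
  fun i' hi' => optReg_mono hε (h i' (hi'.trans (mul_le_mul_of_nonneg_right hρ (nearestDist_nonneg y i))))

/-- The centre of an optically deep ball is `OptReg` (`0 ≤ ρ`). [this node] -/
theorem optReg_of_optDeepReg {ρ ε θ g : ℝ} (hρ : 0 ≤ ρ) {y : Fin N → EuclideanSpace ℝ (Fin 3)} {i : Fin N} (h : OptDeepReg ρ ε θ g y i) :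
    OptReg ε θ g y i :=
  h i (by rw [dist_self]; exact mul_nonneg hρ (nearestDist_nonneg y i))

/-- `Calm` is antitone in `(τ, L)`: calmer and deeper implies calm. [this node] -/
theorem calm_anti {δ τ τ' L L' : ℝ} (hτ : τ' ≤ τ) (hL : L ≤ L') {y : Fin N → EuclideanSpace ℝ (Fin 3)} {i : Fin N} (h : Calm δ τ' L' y i) :
    Calm δ τ L y i := by
  refine ⟨deepReg_anti hL h.1, fun i' hi' => ?_⟩
  have hi'' : dist (y i') (y i) ≤ L' * nearestDist y i := hi'.trans (mul_le_mul_of_nonneg_right hL (nearestDist_nonneg y i))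
  obtain ⟨hw, ht, hg⟩ := h.2 i' hi''
  exact ⟨hw, ht, hg.trans hτ⟩

/-- Calmness is inherited by the sites of the `R·nn`-ball (`0 ≤ R ≤ L`), at depth `(L − R)·δ/2` (in-window nearest distances lie in `[δ, 2]`).
[this node] -/
theorem calm_of_near {δ τ L R : ℝ} (hδ : 0 < δ) (hR : 0 ≤ R) (hRL : R ≤ L) {y : Fin N → EuclideanSpace ℝ (Fin 3)} {i i' : Fin N}
    (h : Calm δ τ L y i) (hi' : dist (y i') (y i) ≤ R * nearestDist y i) : Calm δ τ ((L - R) * δ / 2) y i' := by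
  have hL : 0 ≤ L := hR.trans hRL
  have hwi : InWindow δ 2 y i := (h.2 i (by rw [dist_self]; exact mul_nonneg hL (nearestDist_nonneg y i))).1
  have hwi' : InWindow δ 2 y i' := (h.2 i' (hi'.trans (mul_le_mul_of_nonneg_right hRL (nearestDist_nonneg y i)))).1
  -- the ball of radius `((L-R)δ/2)·nn_{i'}` around `y i'` lies in the ball of radius `L·nn_i` around `y i`
  have hball : ∀ k : Fin N, dist (y k) (y i') ≤ (L - R) * δ / 2 * nearestDist y i' → dist (y k) (y i) ≤ L * nearestDist y i := by
    intro k hk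
    have h1 : (L - R) * δ / 2 * nearestDist y i' ≤ (L - R) * nearestDist y i := by
      have hα : 0 ≤ L - R := by linarith
      have h2 : δ / 2 * nearestDist y i' ≤ nearestDist y i := by
        have := hwi'.2
        have := hwi.1
        nlinarith
      calc (L - R) * δ / 2 * nearestDist y i' = (L - R) * (δ / 2 * nearestDist y i') := by ring
        _ ≤ (L - R) * nearestDist y i := mul_le_mul_of_nonneg_left h2 hα
    calc dist (y k) (y i) ≤ dist (y k) (y i') + dist (y i') (y i) := dist_triangle _ _ _
      _ ≤ (L - R) * nearestDist y i + R * nearestDist y i := add_le_add (hk.trans h1) hi'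
      _ = L * nearestDist y i := by ring
  refine ⟨fun k hk => h.1 k (hball k hk), fun k hk => h.2 k (hball k hk)⟩

/-! ## §4  The weaker sides: `CoarseMid ⇒ LooseCalm`, `CoarseMid ⇒ OpticCalm` (PROVED) -/

/-- A loose calm site is a MID site. [this node] -/
theorem looseCalmCount_le_affMidCount (δ η₂ τ L : ℝ) (y : Fin N → EuclideanSpace ℝ (Fin 3)) :
    looseCalmCount δ η₂ τ L y ≤ affMidCount 64 12 (1 / 10 ^ 4) (1 / 25) (3 / 50) (1 / 450) y := by
  unfold looseCalmCount affMidCount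
  exact natCard_le_of_imp fun i hi => ⟨hi.1, fun hd => hi.2.2.2.2 (affReg_of_affDeepReg (by norm_num) hd)⟩

/-- An optic calm site is a MID site. [this node] -/
theorem opticCalmCount_le_affMidCount (δ η₂ τ L : ℝ) (y : Fin N → EuclideanSpace ℝ (Fin 3)) :
    opticCalmCount δ η₂ τ L y ≤ affMidCount 64 12 (1 / 10 ^ 4) (1 / 25) (3 / 50) (1 / 450) y := by
  unfold opticCalmCount affMidCount
  exact natCard_le_of_imp fun i hi =>
    ⟨hi.1, fun hd => hi.2.2.2 (affReg_mono_theta (by norm_num) (affReg_of_affDeepReg (by norm_num) hd))⟩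

/-- **`CoarseMid ⇒ LooseCalm`.** [this node] -/
theorem looseCalm_of_coarseMid (h : CoarseMid) : LooseCalm := by
  intro δ hδ hδ2
  refine ⟨1, 1, 0, one_pos, one_pos, fun τ L _ _ _ => ?_⟩
  exact censusW_mono (fun y => looseCalmCount_le_affMidCount δ 1 τ L y) (fun _ => le_rfl) (balancedAffMidGapW_iff_censusW.1 (h δ hδ hδ2))

/-- **`CoarseMid ⇒ OpticCalm`.** [this node] -/
theorem opticCalm_of_coarseMid (h : CoarseMid) : OpticCalm := by
  intro δ hδ hδ2
  refine ⟨1, 1, 0, one_pos, one_pos, fun τ L _ _ _ => ?_⟩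
  exact censusW_mono (fun y => opticCalmCount_le_affMidCount δ 1 τ L y) (fun _ => le_rfl) (balancedAffMidGapW_iff_censusW.1 (h δ hδ hδ2))

/-! ## §4b  `DilatedDeep` lies below the apex scale census «TBDSG» (PROVED): no new strength in the cone -/

/-- A dilated site is a `64`-deeply registered LONG scale-bad site at the record spacing `a = 122/125`, margin `0`: its nearest bond is longer
than `21/20 > (122/125)(51/50)`, and no site lies within `(122/125)(51/50)` of it, so it fails the relaxed gapped-twelve test. [this node] -/
theorem dilated_regScaleBad {δ : ℝ} {y : Fin N → EuclideanSpace ℝ (Fin 3)} {j : Fin N} (h : Dilated δ y j) :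
    (Bad (122 / 125) 0 y j ∧ (Short (122 / 125) 0 y j ∨ Long (122 / 125) 0 y j)) ∧ DeepReg 64 (3 / 50) (1 / 450) y j := by
  have hReg : Reg (3 / 50) (1 / 450) y j := h.1 j (by rw [dist_self]; exact mul_nonneg (by norm_num) (nearestDist_nonneg y j))
  have hcf : IsChargeFree (1 / 100 : ℝ) y j := hReg.1
  have hfar : ∀ k : Fin N, k ≠ j → (122 / 125 : ℝ) * (1 + 1 / 50) + 0 < dist (y j) (y k) := fun k hk => by
    have h1 := nearestDist_le_dist y hk
    have h2 := h.2.2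
    linarith
  refine ⟨⟨⟨hcf, fun hRT => ?_⟩, Or.inr ?_⟩, h.1⟩
  · obtain ⟨_, h12, _⟩ := hRT
    have hS : {w ∈ Set.range y | w ≠ y j ∧ dist (y j) w ≤ 122 / 125 * (1 + 1 / 50) + 0} = ∅ := by
      refine Set.subset_empty_iff.1 fun w hw => ?_
      obtain ⟨⟨k, rfl⟩, hne, hd⟩ := hw
      have hkj : k ≠ j := fun hkj => hne (by rw [hkj])
      exact absurd hd (not_le.2 (hfar k hkj))
    rw [hS, Set.ncard_empty] at h12
    omega
  · have hne : ((bondGraph (1 / 100 : ℝ) y).neighborSet j).Nonempty :=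
      Set.nonempty_of_ncard_ne_zero (by rw [hcf.1]; norm_num)
    obtain ⟨k, hk⟩ := hne
    rw [SimpleGraph.mem_neighborSet] at hk
    exact ⟨k, hk, hfar k hk.ne.symm⟩

/-- `#Dilated δ ≤ regScaleCount (122/125) 0 64 (3/50) (1/450)`. [this node] -/
theorem dilatedCount_le_regScaleCount (δ : ℝ) (y : Fin N → EuclideanSpace ℝ (Fin 3)) :
    dilatedCount δ y ≤ regScaleCount (122 / 125) 0 64 (3 / 50) (1 / 450) y := by
  unfold dilatedCount regScaleCount
  exact natCard_le_of_imp fun j hj => dilated_regScaleBad hj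

/-- **`DilatedDeep ⟸ TBDSG`**: the apex scale census `TameBalancedDeepScaleGap (122/125) 0 ρ (3/50) (1/450)` at any depth `ρ ≤ 64` (record: `ρ = 4`,
an INTERNAL node of the record cone) implies `DilatedDeep` — so `DilatedDeep` adds no strength to the leaf set. [this node] -/
theorem dilatedDeep_of_tbdsg {ρ : ℝ} (hρ : ρ ≤ 64) (h : TameBalancedDeepScaleGap (122 / 125) 0 ρ (3 / 50) (1 / 450)) : DilatedDeep := by
  intro δ hδ hδ2
  have h64 : CensusW (fun y => regScaleCount (122 / 125) 0 64 (3 / 50) (1 / 450) y) (fun y => notDeepCount 64 (3 / 50) (1 / 450) y) δ 2 :=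
    tameBalancedDeepScaleGap_mono hρ h δ hδ hδ2
  exact censusW_mono (fun y => dilatedCount_le_regScaleCount δ y) (fun _ => le_rfl) h64

end Summit.AtomisticToContinuum.Crystallization.Theorems.OverbindingBudgetAffineCalmDescent
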